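import Mathlib
import HarnessLib
import Summits.Ventures.LatticeQCDFlow.Scaling.AcceptanceLeCamPairFloorIntegral
import Summits.Ventures.LatticeQCDFlow.TrivializingMaps.AcceptanceFootprint

/-!
# LatticeQCDFlow / Scaling — the training loss floors the acceptance on a GENERAL space:
# `e^{−D(q‖p)} ≤ BC²` and `acc(p, q) ≥ ½·e^{−2·D(q‖p)}` — never vacuous

HONEST FRAMING: exact (Metropolis-corrected) sampling algorithms for lattice gauge theory;
figures of merit are autocorrelation/cost numbers at stated couplings and volumes; no
continuum-physics claim.

Venture `LatticeQCDFlow` (cell pub-lqcd), topic `Scaling`; FANOUT row 3 (`s0-u1-a`, S0-B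
implementation A, GEN-20).  NEW WORK of the cell (elementary), on row 3's GEN-12
`Scaling/AcceptanceLeCamPairFloorIntegral` (`acc ≥ 1 − √(1 − BC⁴)` on a general space), lean-2's
`TrivializingMaps/AcceptanceFootprint` (density plumbing, reused) and Mathlib's
Jensen inequality (`ConvexOn.map_integral_le` for `exp` under the law `q·μ`); NO definition is
introduced; nothing is cited ("KL versus Hellinger" `e^{−D} ≤ BC²` is [folklore] — Polyanskiy–Wu
(7.33); its finite form is the tree's `Literature/Probability/Entropy/BretagnolleHuber`).
SETTING (as in the GEN-12 file): an s-finite measure `μ` on any measurable space, POSITIVE measurable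
densities `p` (target) and `q` (model) with `∫ p = ∫ q = 1`; `acc = ∫∫ min(p(x)q(y), p(y)q(x)) dμ dμ`
is the equilibrium acceptance of the exact flow sampler, `BC = ∫ √(pq) dμ`, and the flow's training
loss is the reverse divergence `D(q‖p) = ∫ q log(q/p) dμ`.

## Content (all `[ours]`)

* (`q·μ` is a probability measure and `∫ h d(q·μ) = ∫ q h dμ` are REUSED from lean-2's
  `TrivializingMaps/AcceptanceFootprint`, imported);
* **`exp_neg_integral_mul_log_le_sq_integral_sqrt`** — `e^{−D(q‖p)} ≤ (∫√(pq))²` (Jensen for `exp`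
  applied to `½ log(p/q)` under `q·μ`);
* `half_pow_four_le_meanAccept` — `BC⁴/2 ≤ acc` (from `1 − √(1 − BC⁴) ≤ acc`);
* **`half_exp_neg_two_mul_kl_le_meanAccept`** — `½·e^{−2·D(q‖p)} ≤ acc(p, q)`: on any configuration
  space, a reverse training loss of `D` nats guarantees an equilibrium acceptance of at least
  `½e^{−2D}`, with no assumption on the flow beyond positivity of the densities; by the symmetry of
  `acc` and `BC`, **`half_exp_neg_two_mul_kl_fwd_le_meanAccept`** — the same with the forward loss
  `D(p‖q)`.

Reading (value-free): the large-volume law `acc → erfc(√(D/2))` of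
`Scaling/AcceptanceAlongCouplingSequences` sits above this floor; unlike the Pinsker floor
`1 − √(2D)` (`Scaling/AcceptancePinskerFloor`, finite) it never becomes vacuous.
NOT CLAIMED: tightness of the exponent; densities vanishing on sets of positive measure (then
`D(q‖p)` may be infinite and the statement is void anyway); any value at the cell's `(β, L)`;
nothing re-scored.
-/

noncomputable section

namespace Summit.Ventures.LatticeQCDFlow.Theory2

open MeasureTheory Set Filter

variable {X : Type*} [MeasurableSpace X] {μ : Measure X} [SFinite μ]

omit [SFinite μ] in
/-- **"KL versus Hellinger" on a general space**: `e^{−D(q‖p)} ≤ (∫ √(pq) dμ)²` for positive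
normalised densities with `q log(q/p) ∈ L¹` (Jensen: `e^{E_q[½log(p/q)]} ≤ E_q[√(p/q)] = BC`).
[folklore] -/
theorem exp_neg_integral_mul_log_le_sq_integral_sqrt {p q : X → ℝ} (hp0 : ∀ x, 0 < p x)
    (hpm : Measurable p) (hpi : Integrable p μ) (hq0 : ∀ x, 0 < q x) (hqm : Measurable q)
    (hqi : Integrable q μ) (hq1 : ∫ x, q x ∂μ = 1)
    (hli : Integrable (fun x => q x * Real.log (q x / p x)) μ) :
    Real.exp (-∫ x, q x * Real.log (q x / p x) ∂μ) ≤ (∫ x, Real.sqrt (p x * q x) ∂μ) ^ 2 := by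
  -- the model law `Q = q·μ`
  set Q : Measure X := μ.withDensity fun x => ENNReal.ofReal (q x) with hQ
  haveI : IsProbabilityMeasure Q :=
    TrivializingMaps.isProbabilityMeasure_withDensity_ofReal (fun x => (hq0 x).le) hqi hq1
  have hfm : Measurable fun x => ENNReal.ofReal (q x) := ENNReal.measurable_ofReal.comp hqm
  have hflt : ∀ᵐ x ∂μ, ENNReal.ofReal (q x) < ⊤ := ae_of_all _ fun x => ENNReal.ofReal_lt_top
  have hint : ∀ g : X → ℝ, ∫ x, g x ∂Q = ∫ x, q x * g x ∂μ := fun g =>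
    TrivializingMaps.integral_withDensity_ofReal_eq (fun x => (hq0 x).le) hqm g
  have hintegrable : ∀ g : X → ℝ, Integrable (fun x => q x * g x) μ → Integrable g Q := fun g hg => by
    rw [hQ, integrable_withDensity_iff_integrable_smul' hfm hflt]
    refine hg.congr (ae_of_all _ fun x => ?_)
    simp only [smul_eq_mul, ENNReal.toReal_ofReal (hq0 x).le]
  -- Jensen for `exp` and `Y = ½ log(p/q)`
  set Y : X → ℝ := fun x => Real.log (p x / q x) / 2 with hY
  have hYi : Integrable Y Q := by
    refine hintegrable Y ?_
    have e : (fun x => q x * Y x) = fun x => (-1 / 2 : ℝ) * (q x * Real.log (q x / p x)) := by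
      funext x
      simp only [hY]
      rw [Real.log_div (hp0 x).ne' (hq0 x).ne', Real.log_div (hq0 x).ne' (hp0 x).ne']
      ring
    rw [e]
    exact hli.const_mul _
  have hexpY : ∀ x, Real.exp (Y x) = Real.sqrt (p x / q x) := fun x => by
    rw [hY, Real.sqrt_eq_rpow, Real.rpow_def_of_pos (div_pos (hp0 x) (hq0 x))]
    congr 1
    ring
  have hqs : ∀ x, q x * Real.sqrt (p x / q x) = Real.sqrt (p x * q x) := fun x => by
    have hqne : q x ≠ 0 := (hq0 x).ne'
    have e : p x * q x = q x ^ 2 * (p x / q x) := by field_simp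
    rw [e, Real.sqrt_mul (sq_nonneg _), Real.sqrt_sq (hq0 x).le]
  have hEi : Integrable (fun x => Real.exp (Y x)) Q := by
    refine hintegrable _ ?_
    have e : (fun x => q x * Real.exp (Y x)) = fun x => Real.sqrt (p x * q x) := by
      funext x
      rw [hexpY, hqs]
    rw [e]
    -- `√(pq) ≤ (p + q)/2`
    have hI : Integrable (fun x => (p x + q x) / 2) μ := (hpi.add hqi).div_const 2
    refine Integrable.mono' hI ((hpm.mul hqm).sqrt.aestronglyMeasurable) (ae_of_all _ fun x => ?_)
    rw [Real.norm_eq_abs, abs_of_nonneg (Real.sqrt_nonneg _)]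
    exact Real.sqrt_le_iff.mpr ⟨by linarith [hp0 x, hq0 x], by nlinarith [sq_nonneg (p x - q x)]⟩
  have hJ := ConvexOn.map_integral_le (μ := Q) (f := Y) (g := Real.exp) (s := Set.univ) convexOn_exp
    Real.continuous_exp.continuousOn isClosed_univ (ae_of_all _ fun _ => Set.mem_univ _) hYi hEi
  -- evaluate both sides
  have hL : ∫ x, Y x ∂Q = -(∫ x, q x * Real.log (q x / p x) ∂μ) / 2 := by
    rw [hint]
    have e : (fun x => q x * Y x) = fun x => (-1 / 2 : ℝ) * (q x * Real.log (q x / p x)) := by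
      funext x
      simp only [hY]
      rw [Real.log_div (hp0 x).ne' (hq0 x).ne', Real.log_div (hq0 x).ne' (hp0 x).ne']
      ring
    rw [e, integral_const_mul]
    ring
  have hR : ∫ x, Real.exp (Y x) ∂Q = ∫ x, Real.sqrt (p x * q x) ∂μ := by
    rw [hint]
    exact integral_congr_ae (ae_of_all _ fun x => by simp only; rw [hexpY, hqs])
  have hJ' : Real.exp (-(∫ x, q x * Real.log (q x / p x) ∂μ) / 2) ≤ ∫ x, Real.sqrt (p x * q x) ∂μ := by
    have := hJ; rw [hL] at this; simpa [Function.comp, hR] using this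
  -- square
  have h0 : 0 ≤ Real.exp (-(∫ x, q x * Real.log (q x / p x) ∂μ) / 2) := (Real.exp_pos _).le
  have hsq := mul_le_mul hJ' hJ' h0 ((h0.trans hJ'))
  rw [← Real.exp_add] at hsq
  have e : -(∫ x, q x * Real.log (q x / p x) ∂μ) / 2 + -(∫ x, q x * Real.log (q x / p x) ∂μ) / 2
      = -∫ x, q x * Real.log (q x / p x) ∂μ := by ring
  rw [e] at hsq
  rw [sq]
  exact hsq

omit [SFinite μ] in
/-- `t/2 ≤ 1 − √(1 − t)` for `t ∈ [0, 1]`. [folklore] -/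
private theorem half_le_one_sub_sqrt {t : ℝ} (ht0 : 0 ≤ t) (ht1 : t ≤ 1) :
    t / 2 ≤ 1 - Real.sqrt (1 - t) := by
  have hs : Real.sqrt (1 - t) ≤ 1 - t / 2 := by
    refine Real.sqrt_le_iff.mpr ⟨by linarith, ?_⟩
    nlinarith
  linarith

/-- **`acc ≥ BC⁴/2` on a general space.** [ours] -/
theorem half_pow_four_le_meanAccept {p q : X → ℝ} (hp0 : ∀ x, 0 ≤ p x) (hpm : Measurable p)
    (hpi : Integrable p μ) (hp1 : ∫ x, p x ∂μ = 1) (hq0 : ∀ x, 0 ≤ q x) (hqm : Measurable q)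
    (hqi : Integrable q μ) (hq1 : ∫ x, q x ∂μ = 1) :
    (∫ x, Real.sqrt (p x * q x) ∂μ) ^ 4 / 2 ≤ ∫ x, ∫ y, min (p x * q y) (p y * q x) ∂μ ∂μ := by
  have h := sq_one_sub_meanAccept_add_pow_four_le_one hp0 hpm hpi hp1 hq0 hqm hqi hq1
  have ht0 : 0 ≤ (∫ x, Real.sqrt (p x * q x) ∂μ) ^ 4 := by positivity
  have ht1 : (∫ x, Real.sqrt (p x * q x) ∂μ) ^ 4 ≤ 1 := by nlinarith [sq_nonneg (1 - ∫ x, ∫ y, min (p x * q y) (p y * q x) ∂μ ∂μ)]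
  have hfloor := one_sub_sqrt_le_meanAccept hp0 hpm hpi hp1 hq0 hqm hqi hq1
  linarith [half_le_one_sub_sqrt ht0 ht1]

/-- **THE TRAINING LOSS FLOORS THE ACCEPTANCE (general space): `½·e^{−2·D(q‖p)} ≤ acc(p, q)`.**
[ours] -/
theorem half_exp_neg_two_mul_kl_le_meanAccept {p q : X → ℝ} (hp0 : ∀ x, 0 < p x)
    (hpm : Measurable p) (hpi : Integrable p μ) (hp1 : ∫ x, p x ∂μ = 1) (hq0 : ∀ x, 0 < q x)
    (hqm : Measurable q) (hqi : Integrable q μ) (hq1 : ∫ x, q x ∂μ = 1)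
    (hli : Integrable (fun x => q x * Real.log (q x / p x)) μ) :
    Real.exp (-(2 * ∫ x, q x * Real.log (q x / p x) ∂μ)) / 2
      ≤ ∫ x, ∫ y, min (p x * q y) (p y * q x) ∂μ ∂μ := by
  have hB := exp_neg_integral_mul_log_le_sq_integral_sqrt hp0 hpm hpi hq0 hqm hqi hq1 hli
  have hfloor := half_pow_four_le_meanAccept (fun x => (hp0 x).le) hpm hpi hp1 (fun x => (hq0 x).le)
    hqm hqi hq1
  have h4 : Real.exp (-(2 * ∫ x, q x * Real.log (q x / p x) ∂μ))
      ≤ (∫ x, Real.sqrt (p x * q x) ∂μ) ^ 4 := by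
    have e : Real.exp (-(2 * ∫ x, q x * Real.log (q x / p x) ∂μ))
        = Real.exp (-∫ x, q x * Real.log (q x / p x) ∂μ) ^ 2 := by
      rw [← Real.exp_nat_mul]; ring_nf
    rw [e, show (∫ x, Real.sqrt (p x * q x) ∂μ) ^ 4 = ((∫ x, Real.sqrt (p x * q x) ∂μ) ^ 2) ^ 2 by ring]
    exact pow_le_pow_left₀ (Real.exp_pos _).le hB 2
  linarith

/-- **… and from the FORWARD loss: `½·e^{−2·D(p‖q)} ≤ acc(p, q)`** (`acc` and `BC` are symmetric in
the two densities). [ours] -/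
theorem half_exp_neg_two_mul_kl_fwd_le_meanAccept {p q : X → ℝ} (hp0 : ∀ x, 0 < p x)
    (hpm : Measurable p) (hpi : Integrable p μ) (hp1 : ∫ x, p x ∂μ = 1) (hq0 : ∀ x, 0 < q x)
    (hqm : Measurable q) (hqi : Integrable q μ) (hq1 : ∫ x, q x ∂μ = 1)
    (hli : Integrable (fun x => p x * Real.log (p x / q x)) μ) :
    Real.exp (-(2 * ∫ x, p x * Real.log (p x / q x) ∂μ)) / 2
      ≤ ∫ x, ∫ y, min (p x * q y) (p y * q x) ∂μ ∂μ := by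
  have h := half_exp_neg_two_mul_kl_le_meanAccept hq0 hqm hqi hq1 hp0 hpm hpi hp1 hli
  have e : ∀ x y : X, min (q x * p y) (q y * p x) = min (p x * q y) (p y * q x) := fun x y => by
    rw [min_comm, mul_comm (q y) (p x), mul_comm (q x) (p y)]
  simp_rw [e] at h
  exact h

end Summit.Ventures.LatticeQCDFlow.Theory2

end
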